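import Summits.ValiantsHypothesis.ValiantsHypothesis.Theorems.LacunarySymmetroidMatrixDescartesTwoSidedTowerWalk
import Summits.ValiantsHypothesis.ValiantsHypothesis.Theorems.LacunarySymmetroidMatrixDescartesCensusMirror

/-!
# `MatrixDescartes` census — two-sided (mirror) Lagrange tower: `ζ_sym(m,4) ≥ m² + 2m` for every `m` (the P4 rung of the cell)

HONEST FRAMING.  Object-search cell `pub-symmetroid`, crux `Theses.LacunarySymmetroid.MatrixDescartes`
(stmt-ValiantsHypothesis-18050); seat val-sym-mdr-p1 (g2).  Part of the kernel port of the cell's TWO-SIDED Lagrange tower P4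
(conjb-3 g4, ROUND4-MEMO §2) in the seat's arrowhead form (`…LagrangeMirrorDefs`): for EVERY `m ≥ 1` some real symmetric FOUR-term
lacunary `m × m` pencil has `m² + 2m` distinct positive determinant roots (`¬ PosRootLawAt m 4 ((m+1)² − 2)`).  A LOWER-bound /
construction statement in census (CONJECTURE-A) currency for the `K = 4` column; it proves nothing about the crux `MatrixDescartes`
(an upper-bound statement at fat formats), nothing about the cubic-vs-quadratic fork beyond this floor, and nothing about `VP ≠ VNP`.
No definitions in this file.

THIS FILE. `pencil4_eq_smul_Gmat` (the two-sided pencil on support `(0, D, D+1, 2D+1)` is `t^D • Gmat` at `t ≠ 0`), symmetry of the four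
letters, and the main theorem `not_posRootLawAt_four (m) (1 ≤ m) : ¬ PosRootLawAt m 4 ((m+1)² − 2)` — an explicit real symmetric four-term
`m × m` lacunary pencil with `(m+1)² − 1 = m² + 2m` distinct positive determinant roots for every `m` (the cell's two-seat certified rows
`(6,4) ≥ 48`, `(7,4) ≥ 63`, `(8,4) ≥ 80` are instances).  Witness letters `(Cᵀ(ε·diagonal(sgnDn·thrDn^D))C, A_m, B_m, diagonal(sgn·thr^{−(D+1)}))`. [folklore]
-/

-- `Summit.ValiantsHypothesis.ValiantsHypothesis.…` repeats a component by the D-0017 layout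
-- (single-conjunct summit), which the `dupNamespace` linter flags; the name is mandated.
set_option linter.dupNamespace false

namespace Summit.ValiantsHypothesis.ValiantsHypothesis.Theorems.LacunarySymmetroidMatrixDescartes.Census.LagrangeTower

open Matrix Polynomial Finset
open scoped BigOperators

section Final

open Filter Topology

/-! ### The two-sided pencil and the main theorem -/

/-- The two-sided pencil at `t ≠ 0` is `t^D • Gmat`. -/
theorem pencil4_eq_smul_Gmat (m D : ℕ) {t : ℝ} (ht : t ≠ 0) :
    ∑ l, t ^ witness4Exps D l • witness4Letters m D l = t ^ D • Gmat m D t := by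
  simp only [Fin.sum_univ_four, witness4Exps, witness4Letters, Matrix.cons_val_zero, Matrix.cons_val_one,
    Matrix.cons_val_two, Matrix.cons_val_three, Matrix.head_cons, Matrix.tail_cons, pow_zero, one_smul]
  unfold Gmat dnLetter upLetter
  rw [smul_add, smul_add, smul_add, smul_smul, ← pow_succ]
  have h1 : t ^ D • diagonal (fun a : Fin m => sgn a * (t / thr a) ^ (D + 1))
      = t ^ (2 * D + 1) • diagonal (fun a : Fin m => sgn a * (thr a)⁻¹ ^ (D + 1)) := by
    rw [← Matrix.diagonal_smul, ← Matrix.diagonal_smul]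
    congr 1; funext a
    simp only [Pi.smul_apply, smul_eq_mul, div_eq_mul_inv, mul_pow]
    ring
  have hv : (t ^ D • fun a : Fin m => sgnDn m a * (thrDn m a / t) ^ D) = fun a : Fin m => sgnDn m a * thrDn m a ^ D := by
    funext a
    simp only [Pi.smul_apply, smul_eq_mul, div_pow]
    field_simp
  have h2 : t ^ D • ((congC m)ᵀ * (congEps m • diagonal fun a : Fin m => sgnDn m a * (thrDn m a / t) ^ D) * congC m)
      = (congC m)ᵀ * (congEps m • diagonal fun a : Fin m => sgnDn m a * thrDn m a ^ D) * congC m := by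
    rw [← Matrix.smul_mul, ← Matrix.mul_smul, smul_comm, ← Matrix.diagonal_smul, hv]
  rw [h1, h2]
  abel

/-- The two-sided witness letters are symmetric. -/
theorem witness4Letters_isSymm (m D : ℕ) (l : Fin 4) : (witness4Letters m D l).IsSymm := by
  have h := level_symm (tower m) (tower_good m)
  fin_cases l
  · show (dnLetter m D).IsSymm
    unfold dnLetter Matrix.IsSymm
    rw [Matrix.transpose_mul, Matrix.transpose_mul, Matrix.transpose_transpose, Matrix.transpose_smul,
      Matrix.diagonal_transpose, Matrix.mul_assoc]
  · exact h.1
  · exact h.2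
  · show (upLetter m D).IsSymm
    exact Matrix.diagonal_transpose _

open Summit.ValiantsHypothesis.ValiantsHypothesis.Theorems.MatrixDescartes.Negative (PosRootLawAt) in
/-- **THE `K = 4` RUNG (the cell's P4), kernel form: `ζ_sym(m,4) ≥ m² + 2m` for every `m ≥ 1`** —
`¬ PosRootLawAt m 4 ((m+1)² − 2)`, i.e. some real symmetric four-term `m × m` lacunary pencil has `(m+1)² − 1 = m² + 2m` distinct positive
determinant roots (witness: the two-sided arrowhead Lagrange tower on the support `(0, D, D+1, 2D+1)`, `D` large). -/
theorem not_posRootLawAt_four (m : ℕ) (hm : 1 ≤ m) : ¬ PosRootLawAt m 4 ((m + 1) ^ 2 - 2) := by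
  intro hlaw
  obtain ⟨D, hD⟩ := exists_D_alternating4 m hm
  set N := tri m + tri (m + 1) - 1 with hN
  have hsq := tri_add_tri_succ m
  have hN2 : 2 ≤ tri m + tri (m + 1) := by rw [hsq]; nlinarith
  let τ : Fin (N + 1) → ℝ := fun i => cpts m i
  have hτ : StrictMono τ := by
    refine Fin.strictMono_iff_lt_succ.mpr fun i => ?_
    show cpts m (Fin.castSucc i) < cpts m i.succ
    rw [Fin.val_castSucc, Fin.val_succ]
    exact cpts_lt_succ m i hm (by omega)
  have hpos : ∀ i, 0 < τ i := fun i => cpts_pos m i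
  set p := Matrix.det (∑ l, ((Polynomial.X : Polynomial ℝ) ^ witness4Exps D l) • (witness4Letters m D l).map Polynomial.C)
    with hp
  have heval : ∀ t : ℝ, 0 < t → p.eval t = (t ^ D) ^ m * Matrix.det (Gmat m D t) := by
    intro t ht
    rw [hp, eval_det_pencil_eq, pencil4_eq_smul_Gmat m D ht.ne', Matrix.det_smul, Fintype.card_fin]
  have halt : ∀ i : Fin N, p.eval (τ i.castSucc) * p.eval (τ i.succ) < 0 := by
    intro i
    show p.eval (cpts m (Fin.castSucc i)) * p.eval (cpts m i.succ) < 0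
    rw [Fin.val_castSucc, Fin.val_succ, heval _ (cpts_pos m i), heval _ (cpts_pos m (i + 1))]
    have hneg := hD i (by omega)
    have h1 : 0 < (cpts m i ^ D) ^ m := by have := cpts_pos m i; positivity
    have h2 : 0 < (cpts m (i + 1) ^ D) ^ m := by have := cpts_pos m (i + 1); positivity
    have : (cpts m ↑i ^ D) ^ m * Matrix.det (Gmat m D (cpts m ↑i)) * ((cpts m (↑i + 1) ^ D) ^ m * Matrix.det (Gmat m D (cpts m (↑i + 1))))
        = ((cpts m ↑i ^ D) ^ m * (cpts m (↑i + 1) ^ D) ^ m) *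
          (Matrix.det (Gmat m D (cpts m ↑i)) * Matrix.det (Gmat m D (cpts m (↑i + 1)))) := by ring
    rw [this]
    exact mul_neg_of_pos_of_neg (mul_pos h1 h2) hneg
  have hcount := Literature.LinearAlgebra.MatrixPolynomials.CameronPsarrakos2019.le_card_posRoots_of_alternating p N τ hτ hpos halt
  have hbound := hlaw (witness4Exps D) (witness4Letters m D) (witness4Letters_isSymm m D)
  rw [← hp] at hbound
  omega

end Final

end Summit.ValiantsHypothesis.ValiantsHypothesis.Theorems.LacunarySymmetroidMatrixDescartes.Census.LagrangeTower
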